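import Summits.ResolutionOfSingularities.ResolutionOfSingularities.Theorems.FrobeniusLadderFInjectiveMacaulayficationFHalfRowOfProductCentre
import Summits.ResolutionOfSingularities.ResolutionOfSingularities.Theorems.FrobeniusLadderFInjectiveMacaulayficationP2d5CTauKBlowupFull
import HarnessLib

/-!
# d = 5 ROW #1, CURE HALF: the τ-floor of P2d5C is cured by ONE fibre-supported blowing up — the F-half's conclusion at `(5, 2, P2d5C, v, Bl_τ, τ·𝒪)`, UNCONDITIONAL
# (crux `FInjectiveMacaulayfication` stmt-ResolutionOfSingularities-15315, chain w45a; res-L1-w45a-plan-1 RULING R19.15 / SEAT TABLE v32.5 «stub-2 (successor of g8) —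
# d = 5 row #1 cure half»; seat res-L1-w45a-stub-2 g9; the d = 5 twin of `TauFloorP2d4CRow.tauFloor_P2d4C_row` p620828 (res-L1-w45a-stub-3) / `TauFloorP2d4BRow` p630677;
# input side of the same row = res-L1-w45a-stub-1 g11's `tauFloor_P2d5C_input_legal` / `tauFloor_P2d5C_not_full` (same `f`, same `v`, same `τ`, STATUS l.81206))

[OURS · L1 W4.5a] Support file (`--supports stmt-ResolutionOfSingularities-15315 --as helper`); def-free, unconditional; replaces the role of NO printed item;
NOT a statement of the manuscript; AI-written (AI review is weaker than expert review).

`X = Spec (k[X₀..X₅]/(f))`, `f = X5 ^ 2 + X0 ^ 4 * X5 + X1 ^ 3 + X2 ^ 3 + X3 ^ 3 + X4 ^ 3` (P2d5C: `z² + x⁴z + y³ + u³ + t³ + s³`, res-L1-w45a-idea-1 FB5-r5 §3.3's first `d = 5`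
specimen), `char k = 2` (any field), `v` = the vertex, `τ = (x̄², ȳ, ū, t̄, s̄, z̄)` = the τ-floor centre. THEN: for EVERY blowing up `g : S′ → Spec 𝒪_{X,v}` along `τ·𝒪_{X,v}`
there is `𝓚 ≠ ⊥` on `S′`, supported over the closed point, ALL of whose blowings up are FULL at every stalk. One term: res-L1-w45a-stub-3's generic
`FHalfRowOfProductCentre.fHalfConclusion_of_affineBlowup_mul` (p618085 §2) on `P2d5CTauKBlowupFull.hrow_P2d5C` (res-L1-w45a-stub-2 g9's OWN product certificate
3b1474399fbc90bb: fan = star subdivisions of the orthant of `ℤ⁶` at `(1,1,1,1,1,1) → (1,2,2,2,2,2) → (1,2,2,2,2,3)`, 16 unimodular charts, every strict transform with a split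
class `c_r = 1` (F-pure everywhere, Fedder); `K` = 32 monomials, `𝔪`-primary, `𝔪_v ⊆ √K`; `span_tau_ne_bot`, `span_KA_ne_bot`, `span_range_X_le_radical_span_KA`).
CENSUS NOTE (res-L1-w45a-tri-2's lens, as for the d = 4 rows): the OUTPUT here is an F(5)-iso-currency fact about `(X, v)` with centre `τ·K`; what makes it «F(5)-pos row #1»
is the INPUT legality of `S′ = Bl_τ X` — CM, regular off the closed fibre, non-FULL along a positive-dimensional locus — res-L1-w45a-stub-1 g11's half.
[OURS · certificate instance] [cite: StacksProject, Tag 080A] [cite: GortzWedhorn2020, Prop. 13.92]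
-/

-- single-problem summit: the doubled namespace component is forced
set_option linter.dupNamespace false

noncomputable section

open AlgebraicGeometry CategoryTheory Literature.AlgebraicGeometry.Resolution TopologicalSpace IsLocalRing MvPolynomial

namespace Summit.ResolutionOfSingularities.ResolutionOfSingularities.Theorems.FInjectiveMacaulayfication.TauFloorP2d5CRow

open Summit.ResolutionOfSingularities.ResolutionOfSingularities.Theorems.FInjectiveMacaulayfication
open SliceableCentre

/-- ★★★ **d = 5 ROW #1 (P2d5C), CURE HALF, UNCONDITIONAL.** See the module docstring. [OURS · certificate instance] [cite: StacksProject, Tag 080A] -/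
theorem tauFloor_P2d5C_row (k : Type) [Field k] [CharP k 2] (f : MvPolynomial (Fin 6) k)
    (hf : f = X 5 ^ 2 + X 0 ^ 4 * X 5 + X 1 ^ 3 + X 2 ^ 3 + X 3 ^ 3 + X 4 ^ 3)
    (v : Spec (.of (MvPolynomial (Fin 6) k ⧸ Ideal.span {f})))
    (hv : v.asIdeal = Ideal.span (Set.range fun j : Fin 6 => Ideal.Quotient.mk (Ideal.span {f}) (X j))) :
    ∀ (S' : Scheme.{0}) (g : S' ⟶ Spec ((Spec (.of (MvPolynomial (Fin 6) k ⧸ Ideal.span {f}))).presheaf.stalk v)),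
      IsBlowup g ((affineBlowup.idealSheaf
        (Ideal.span {Ideal.Quotient.mk (Ideal.span {f}) (X 0) ^ 2, Ideal.Quotient.mk (Ideal.span {f}) (X 1),
          Ideal.Quotient.mk (Ideal.span {f}) (X 2), Ideal.Quotient.mk (Ideal.span {f}) (X 3), Ideal.Quotient.mk (Ideal.span {f}) (X 4),
          Ideal.Quotient.mk (Ideal.span {f}) (X 5)})).comap
        ((Spec (.of (MvPolynomial (Fin 6) k ⧸ Ideal.span {f}))).fromSpecStalk v)) →
      ∃ 𝓚 : S'.IdealSheafData, 𝓚 ≠ ⊥ ∧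
        (∀ s ∈ (𝓚.support : Set S'), g.base s = closedPoint ((Spec (.of (MvPolynomial (Fin 6) k ⧸ Ideal.span {f}))).presheaf.stalk v)) ∧
        ∀ (S'' : Scheme.{0}) (π : S'' ⟶ S'), IsBlowup π 𝓚 → ∀ s : S'', FullCl 2 (S''.presheaf.stalk s) := by
  haveI hp : (Ideal.span {f}).IsPrime :=
    (Ideal.span_singleton_prime (P2d5CSpecimen.prime_f k f hf).ne_zero).mpr (P2d5CSpecimen.prime_f k f hf)
  haveI : IsDomain (MvPolynomial (Fin 6) k ⧸ Ideal.span {f}) := Ideal.Quotient.isDomain _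
  exact FHalfRowOfProductCentre.fHalfConclusion_of_affineBlowup_mul 2 _ _ (P2d5CTauKBlowupFull.span_tau_ne_bot k f hf)
    (P2d5CTauKBlowupFull.span_KA_ne_bot k f hf) v (by rw [hv]; exact P2d5CTauKBlowupFull.span_range_X_le_radical_span_KA k f)
    (P2d5CTauKBlowupFull.hrow_P2d5C k f hf)

end Summit.ResolutionOfSingularities.ResolutionOfSingularities.Theorems.FInjectiveMacaulayfication.TauFloorP2d5CRow

end
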